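import Mathlib
import HarnessLib

/-!
# Separation of arbitrary disjoint convex sets in finite dimension

Blekherman–Parrilo–Thomas, *Semidefinite Optimization and Convex Algebraic Geometry* (2012),
Appendix A, §A.3.3, Theorem A.16 (bib: `BlekhermanParriloThomas2012`, held chunk p0437), together
with the supporting-hyperplane corollaries of Rockafellar, *Convex Analysis*, §11 (bib:
`Rockafellar1970`, Cor. 11.5.2 held chunk p0094, Cor. 11.6.1 held chunk p0095).

**Theorem A.16.** Let `K₁, K₂` be convex subsets of `ℝⁿ` with `K₁ ∩ K₂ = ∅`. Then there is an
affine hyperplane separating them: a *nonzero* linear functional `f` and a constant `c` with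
`f ≤ c` on `K₁` and `c ≤ f` on `K₂` (`exists_separating_of_disjoint`).

No topological hypothesis (open / closed / compact / nonempty interior) is required — this is
special to finite dimension.  Mathlib's geometric Hahn–Banach family
(`geometric_hahn_banach_open`, `geometric_hahn_banach_compact_closed`,
`geometric_hahn_banach_point_closed`, …) and the tree's
`Literature.Analysis.Convex.ConvexSandwichTheorem.separation` (Borwein–Zhu Thm 4.3.8: nonempty
interior) each carry such a hypothesis; Theorem A.17 of the book (compact / closed, strict
separation) *is* Mathlib's `geometric_hahn_banach_compact_closed` and is not restated here.
(Both sets must be nonempty for a nonzero `f`: `K₁ = ∅`, `K₂ = ℝⁿ` admits none.)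

The engine is the finite-dimensional supporting-hyperplane theorem
(`exists_forall_le_apply_of_notMem_interior`, Rockafellar Cor. 11.6.1 "a convex set has a non-zero
normal at each of its boundary points", stated for every `x ∉ interior K`): if `affineSpan ℝ K = ⊤`
then `interior K ≠ ∅` (`Convex.interior_nonempty_iff_affineSpan_eq_top`) and
`geometric_hahn_banach_open_point` separates `x` from the open convex set `interior K`, the
inequality passing to `closure (interior K) = closure K ⊇ K`; otherwise the direction of
`affineSpan ℝ K` is a proper subspace, some nonzero linear `g` vanishes on it
(`Submodule.exists_le_ker_of_lt_top`), so `g` is constant on `K` and `±g` does the job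
(this case is Rockafellar Cor. 11.5.2: a convex set other than `ℝⁿ` lies in a closed half-space,
`exists_forall_le_of_ne_univ`).  Theorem A.16 is the point case `0 ∉ K₁ - K₂`.
-/

namespace Literature.Analysis.Convex.FiniteDimConvexSeparation

open Set
open scoped Pointwise

variable {E : Type*} [NormedAddCommGroup E] [NormedSpace ℝ E]

/-- **Supporting hyperplane at a non-interior point** (finite dimension, no further hypothesis):
if `K` is a nonempty convex set and `x ∉ interior K`, some nonzero continuous linear functional
attains on `K` no value larger than its value at `x`.
[cite: Rockafellar1970, §11 Cor 11.6.1 (held chunk p0095)] -/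
theorem exists_forall_le_apply_of_notMem_interior [FiniteDimensional ℝ E] {K : Set E}
    (hK : Convex ℝ K) (hne : K.Nonempty) {x : E} (hx : x ∉ interior K) :
    ∃ f : E →L[ℝ] ℝ, f ≠ 0 ∧ ∀ y ∈ K, f y ≤ f x := by
  by_cases htop : affineSpan ℝ K = ⊤
  · -- full-dimensional case: separate `x` from the open convex set `interior K`
    have hint : (interior K).Nonempty := hK.interior_nonempty_iff_affineSpan_eq_top.2 htop
    obtain ⟨f, hf⟩ := geometric_hahn_banach_open_point hK.interior isOpen_interior hx
    obtain ⟨a, ha⟩ := hint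
    refine ⟨f, fun h => ?_, fun y hy => ?_⟩
    · have h1 := hf a ha
      rw [h] at h1
      exact lt_irrefl _ h1
    · have hcl : y ∈ closure (interior K) := by
        rw [hK.closure_interior_eq_closure_of_nonempty_interior ⟨a, ha⟩]
        exact subset_closure hy
      exact closure_minimal (t := {z | f z ≤ f x}) (fun z hz => (hf z hz).le)
        (isClosed_le f.continuous continuous_const) hcl
  · -- lower-dimensional case: a nonzero linear functional constant on `K`
    obtain ⟨x₀, hx₀⟩ := hne
    have hne' : (affineSpan ℝ K : Set E).Nonempty := ⟨x₀, mem_affineSpan ℝ hx₀⟩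
    have hdir : (affineSpan ℝ K).direction ≠ ⊤ := fun h =>
      htop ((AffineSubspace.direction_eq_top_iff_of_nonempty hne').1 h)
    obtain ⟨g, hg0, hker⟩ :=
      Submodule.exists_le_ker_of_lt_top _ (lt_top_iff_ne_top.2 hdir)
    have hconst : ∀ y ∈ K, g y = g x₀ := by
      intro y hy
      have hmem : y -ᵥ x₀ ∈ (affineSpan ℝ K).direction :=
        AffineSubspace.vsub_mem_direction (mem_affineSpan ℝ hy) (mem_affineSpan ℝ hx₀)
      have h1 := hker hmem
      rwa [LinearMap.mem_ker, vsub_eq_sub, map_sub, sub_eq_zero] at h1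
    have hgc0 : LinearMap.toContinuousLinearMap g ≠ 0 := by
      intro h
      apply hg0
      ext z
      have h1 := congrArg (fun φ : E →L[ℝ] ℝ => φ z) h
      simpa using h1
    by_cases hsign : g x₀ ≤ g x
    · refine ⟨LinearMap.toContinuousLinearMap g, hgc0, fun y hy => ?_⟩
      simp only [LinearMap.coe_toContinuousLinearMap', hconst y hy]
      exact hsign
    · refine ⟨-LinearMap.toContinuousLinearMap g, neg_ne_zero.2 hgc0, fun y hy => ?_⟩
      change -(g y) ≤ -(g x)
      rw [hconst y hy]
      linarith [lt_of_not_ge hsign]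

/-- Point form: if `x ∉ K` for a nonempty convex `K` (finite dimension), a nonzero continuous
linear functional satisfies `f ≤ f x` on `K` — Theorem A.16 with `K₁ = K`, `K₂ = {x}`.
[cite: BlekhermanParriloThomas2012, App. A §A.3.3 Thm A.16 (point case; held chunk p0437)] -/
theorem exists_forall_le_apply_of_notMem [FiniteDimensional ℝ E] {K : Set E}
    (hK : Convex ℝ K) (hne : K.Nonempty) {x : E} (hx : x ∉ K) :
    ∃ f : E →L[ℝ] ℝ, f ≠ 0 ∧ ∀ y ∈ K, f y ≤ f x :=
  exists_forall_le_apply_of_notMem_interior hK hne (fun h => hx (interior_subset h))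

/-- A convex set other than the whole (finite-dimensional) space lies in a closed half-space:
some nonzero continuous linear functional is bounded above on it.
[cite: Rockafellar1970, §11 Cor 11.5.2 (held chunk p0094)] -/
theorem exists_forall_le_of_ne_univ [FiniteDimensional ℝ E] [Nontrivial E] {K : Set E}
    (hK : Convex ℝ K) (hKu : K ≠ univ) :
    ∃ (f : E →L[ℝ] ℝ) (c : ℝ), f ≠ 0 ∧ ∀ y ∈ K, f y ≤ c := by
  rcases K.eq_empty_or_nonempty with rfl | hne
  · obtain ⟨v, hv⟩ := exists_ne (0 : E)
    obtain ⟨f, hfv⟩ := SeparatingDual.exists_ne_zero (R := ℝ) hv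
    refine ⟨f, 0, ?_, fun y hy => hy.elim⟩
    rintro rfl
    exact hfv (by simp)
  · obtain ⟨x, hx⟩ := (ne_univ_iff_exists_notMem K).1 hKu
    obtain ⟨f, hf0, hf⟩ := exists_forall_le_apply_of_notMem hK hne hx
    exact ⟨f, f x, hf0, hf⟩

/-- **Theorem A.16 (separation of disjoint convex sets in finite dimension).**  If `K₁, K₂` are
nonempty disjoint convex subsets of a finite-dimensional real normed space, there are a nonzero
continuous linear functional `f` and a constant `c` with `f ≤ c` on `K₁` and `c ≤ f` on `K₂`
(the affine hyperplane `{f = c}` separates them).  No openness, closedness or interior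
hypothesis is needed.
[cite: BlekhermanParriloThomas2012, App. A §A.3.3 Thm A.16 (held chunk p0437)] -/
theorem exists_separating_of_disjoint [FiniteDimensional ℝ E] {K₁ K₂ : Set E}
    (hK₁ : Convex ℝ K₁) (hK₂ : Convex ℝ K₂) (hne₁ : K₁.Nonempty) (hne₂ : K₂.Nonempty)
    (hdisj : Disjoint K₁ K₂) :
    ∃ (f : E →L[ℝ] ℝ) (c : ℝ), f ≠ 0 ∧ (∀ a ∈ K₁, f a ≤ c) ∧ ∀ b ∈ K₂, c ≤ f b := by
  have hK : Convex ℝ (K₁ - K₂) := hK₁.sub hK₂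
  have hneK : (K₁ - K₂).Nonempty := hne₁.sub hne₂
  have h0 : (0 : E) ∉ K₁ - K₂ := by
    rintro ⟨a, ha, b, hb, hab⟩
    rw [sub_eq_zero] at hab
    exact Set.disjoint_left.1 hdisj ha (hab ▸ hb)
  obtain ⟨f, hf0, hf⟩ := exists_forall_le_apply_of_notMem hK hneK h0
  have hle : ∀ a ∈ K₁, ∀ b ∈ K₂, f a ≤ f b := by
    intro a ha b hb
    have h1 := hf (a - b) (sub_mem_sub ha hb)
    rw [map_sub, map_zero] at h1
    linarith
  obtain ⟨b₀, hb₀⟩ := hne₂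
  refine ⟨f, sSup (f '' K₁), hf0, fun a ha => ?_, fun b hb => ?_⟩
  · exact le_csSup ⟨f b₀, by rintro _ ⟨a', ha', rfl⟩; exact hle a' ha' b₀ hb₀⟩ ⟨a, ha, rfl⟩
  · exact csSup_le (hne₁.image f) (by rintro _ ⟨a', ha', rfl⟩; exact hle a' ha' b hb)

/-- Theorem A.16 in the book's `ℓ ≥ 0 on K₁, ℓ ≤ 0 on K₂` form: an affine functional
`ℓ = f - c` with `f ≠ 0` that is nonnegative on `K₁` and nonpositive on `K₂`.
[cite: BlekhermanParriloThomas2012, App. A §A.3.3 Thm A.16 (held chunk p0437)] -/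
theorem exists_affine_separating_of_disjoint [FiniteDimensional ℝ E] {K₁ K₂ : Set E}
    (hK₁ : Convex ℝ K₁) (hK₂ : Convex ℝ K₂) (hne₁ : K₁.Nonempty) (hne₂ : K₂.Nonempty)
    (hdisj : Disjoint K₁ K₂) :
    ∃ (f : E →L[ℝ] ℝ) (c : ℝ), f ≠ 0 ∧ (∀ a ∈ K₁, 0 ≤ f a - c) ∧ ∀ b ∈ K₂, f b - c ≤ 0 := by
  obtain ⟨f, c, hf0, h₁, h₂⟩ := exists_separating_of_disjoint hK₂ hK₁ hne₂ hne₁ hdisj.symm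
  exact ⟨f, c, hf0, fun a ha => sub_nonneg.2 (h₂ a ha), fun b hb => sub_nonpos.2 (h₁ b hb)⟩

end Literature.Analysis.Convex.FiniteDimConvexSeparation
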